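import Mathlib.GroupTheory.OrderOfElement
import Mathlib.Tactic.Abel
import HarnessLib

/-!
# Route `CMKolyvaginAtInertTwo`, crux `CMKolyvaginExactAtInertTwo` (stmt-BirchSwinnertonDyer-24277):
# THE COUNT IDENTITY `#Ш(E/K)[2^∞] = #Ш(E/ℚ)[2^∞] · #Ш(E^{(d_K)}/ℚ)[2^∞]`, Ia —
# halving in a subgroup of odd order and the averaging trick for an involution

Seat `bsd-line-cmk2-p1` g15 (cell `bsd-print-cf2`); helper (`--supports stmt-BirchSwinnertonDyer-24277`).
THEOREMS ONLY (pure group theory): no definition, no named fact, no `sorry`; no item is closed; BSD is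
not proved by this.

Used by `…ShaCountRegulatorAtTwo` to make the regulator comparison `Reg(E_K) = 2·Reg(E)·Reg(E^{(c)})`
EXACT when `#E(K)_tors` is odd: for an involution `σ` of an abelian group preserving a subgroup `T`
of odd order, a class `g` with `σ g ≡ ± g (mod T)` has a representative `g' ≡ g (mod T)` with
`σ g' = ± g'` exactly (halve the defect `σ g ∓ g = 2s ∈ T`; `σ s = ∓ s`; `g' = g ± s`).

* `exists_nsmul_two_eq_of_odd`, `eq_zero_of_two_nsmul_eq_zero_of_odd` — multiplication by `2` is a
  bijection of a subgroup of odd order (Mathlib `Nat.Coprime.nsmul_right_bijective`);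
* `exists_fixed_generator_of_odd`, `exists_antifixed_generator_of_odd` — the averaging trick.

References: Silverman *AEC* Ex. 10.16 (where it is used); elementary.
-/

-- single-conjunct summit: `Summit.BirchSwinnertonDyer.BirchSwinnertonDyer.…` repeats the name by design
set_option linter.dupNamespace false
set_option autoImplicit false

namespace Summit.BirchSwinnertonDyer.BirchSwinnertonDyer.Theorems.ShaCountTwo

universe u

/-! ## §1 Halving in a subgroup of odd order -/

/-- In a subgroup `H` of odd (finite) order, every element is twice an element of `H`
(multiplication by `2` is a bijection of a finite group of order prime to `2`, Mathlib
`Nat.Coprime.nsmul_right_bijective`). [folklore] -/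
theorem exists_nsmul_two_eq_of_odd {G : Type u} [AddCommGroup G] (H : AddSubgroup G)
    (hodd : Odd (Nat.card H)) {t : G} (ht : t ∈ H) : ∃ s ∈ H, (2 : ℕ) • s = t := by
  have hcop : (Nat.card H).Coprime 2 := Nat.coprime_two_right.mpr hodd
  obtain ⟨s, hs⟩ := (Nat.Coprime.nsmul_right_bijective hcop).surjective ⟨t, ht⟩
  refine ⟨(s : G), s.2, ?_⟩
  have h := congrArg Subtype.val hs
  simpa using h

/-- A subgroup `H` of odd (finite) order has no element of order `2`: `x ∈ H`, `2 • x = 0 ⟹ x = 0`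
(injectivity of multiplication by `2`, Mathlib `Nat.Coprime.nsmul_right_bijective`). [folklore] -/
theorem eq_zero_of_two_nsmul_eq_zero_of_odd {G : Type u} [AddCommGroup G] (H : AddSubgroup G)
    (hodd : Odd (Nat.card H)) {x : G} (hx : x ∈ H) (h2 : (2 : ℕ) • x = 0) : x = 0 := by
  have hcop : (Nat.card H).Coprime 2 := Nat.coprime_two_right.mpr hodd
  have hinj := (Nat.Coprime.nsmul_right_bijective hcop).injective
  have h : (fun y : H => 2 • y) ⟨x, hx⟩ = (fun y : H => 2 • y) 0 := by
    apply Subtype.ext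
    simpa using h2
  have := hinj h
  simpa using congrArg Subtype.val this

/-! ## §2 The averaging trick: a `σ`-fixed (resp. anti-fixed) generator modulo odd torsion -/

section Averaging

variable {P : Type u} [AddCommGroup P] (σ : P →+ P) (T : AddSubgroup P)

/-- **Averaging, `+` version.** If `σ` is an involution preserving the subgroup `T` of odd order and
`σ g − g ∈ T`, then some `g' ≡ g (mod T)` is `σ`-FIXED: with `σ g − g = t = 2s`, `s ∈ T`, one has
`σ t = −t`, hence `σ s = −s` (no `2`-torsion in `T`), and `g' = g + s` works. [folklore] -/
theorem exists_fixed_generator_of_odd (hσσ : ∀ x, σ (σ x) = x) (hσT : ∀ x ∈ T, σ x ∈ T)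
    (hodd : Odd (Nat.card T)) {g : P} (hg : σ g - g ∈ T) :
    ∃ g' : P, g' - g ∈ T ∧ σ g' = g' := by
  obtain ⟨s, hsT, hs⟩ := exists_nsmul_two_eq_of_odd T hodd hg
  have hσt : σ (σ g - g) = -(σ g - g) := by rw [map_sub, hσσ]; abel
  have hσs : σ s = -s := by
    have hmem : σ s + s ∈ T := T.add_mem (hσT s hsT) hsT
    have h0 : (2 : ℕ) • (σ s + s) = 0 := by
      rw [smul_add, ← map_nsmul, hs, hσt]; abel
    have := eq_zero_of_two_nsmul_eq_zero_of_odd T hodd hmem h0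
    exact eq_neg_of_add_eq_zero_left this
  refine ⟨g + s, by simpa using hsT, ?_⟩
  have hσg : σ g = g + (2 : ℕ) • s := by rw [hs]; abel
  rw [map_add, hσs, hσg, two_nsmul]; abel

/-- **Averaging, `−` version.** If `σ` is an involution preserving the subgroup `T` of odd order and
`σ g + g ∈ T`, then some `g' ≡ g (mod T)` is `σ`-ANTI-fixed (`σ g' = −g'`): with
`σ g + g = t = 2s`, `σ t = t`, `σ s = s`, take `g' = g − s`. [folklore] -/
theorem exists_antifixed_generator_of_odd (hσσ : ∀ x, σ (σ x) = x) (hσT : ∀ x ∈ T, σ x ∈ T)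
    (hodd : Odd (Nat.card T)) {g : P} (hg : σ g + g ∈ T) :
    ∃ g' : P, g' - g ∈ T ∧ σ g' = -g' := by
  obtain ⟨s, hsT, hs⟩ := exists_nsmul_two_eq_of_odd T hodd hg
  have hσt : σ (σ g + g) = σ g + g := by rw [map_add, hσσ, add_comm]
  have hσs : σ s = s := by
    have hmem : σ s - s ∈ T := T.sub_mem (hσT s hsT) hsT
    have h0 : (2 : ℕ) • (σ s - s) = 0 := by
      rw [smul_sub, ← map_nsmul, hs, hσt, sub_self]
    have := eq_zero_of_two_nsmul_eq_zero_of_odd T hodd hmem h0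
    exact sub_eq_zero.mp this
  refine ⟨g - s, by simpa using T.neg_mem hsT, ?_⟩
  have hσg : σ g = (2 : ℕ) • s - g := by rw [hs]; abel
  rw [map_sub, hσs, hσg, two_nsmul]; abel

end Averaging

end Summit.BirchSwinnertonDyer.BirchSwinnertonDyer.Theorems.ShaCountTwo
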